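import Literature.AlgebraicGeometry.Motives.AbelianVarietyPicZeroOfAmple
import Literature.Geometry.Kaehler.ComplexTorusAmpleLineBundle
import Literature.Geometry.Kaehler.ComplexTorusLineBundleSectionsTheta
import HarnessLib

/-!
# An ample divisor on a complex abelian variety has a POSITIVE Néron–Severi form:
# `Θ` ample ⇒ `H = c₁(𝒪(Θ)^an)` is a Riemann form (Lange 2023, Prop. 2.1.11 (i)/(iii) ⇒ (ii); Mumford §6 App. 1)

Layer `Literature/AlgebraicGeometry/Motives`, namespace `Literature.AlgebraicGeometry.Motives.AbelianVariety`
(with two generic lemmas in `Literature.Geometry.Kaehler.ComplexTorus` and `Literature.AlgebraicGeometry.HodgeTheory`).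
Cell `hodgecm-mathlib` (D-0151), rung-0 U-DAG on `hDel`, B4 (d) residual leaf (2) «POSITIVITY» of
`B-provers/B-p03/RESIDUAL-B4d-unconditional` (router B-plan1 R67 (2)).  THEOREMS ONLY: no definition, no named
fact, no instance.

Setting (as in `AbelianVarietyPicZeroOfAmple`): a complex abelian variety `A` with a torus uniformisation
`φ : X = V/Φ(ℤ^ι) → A(ℂ)` (`IsAnalytification`, compatible with the group laws), a Cartier divisor `Θ` on `A`, and
an Appell–Humbert datum `p = (H, χ) ∈ 𝒫(Λ)` of the analytified line bundle: `AHData.toPic p = [𝒪_A(Θ)^an]` in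
`Pic(X) = H¹(Λ, H⁰(𝒪_V^*))` (such a `p` always exists, `AHData.toPic_surjective`).  MAIN RESULT
`AbelianVariety.isRiemannForm_of_isAmple`: **if `Θ` is ample then `E = Im H = p.form` is a Riemann form**
(`IsRiemannForm Φ p.form`: type `(1,1)`, integral on `Λ`, and `H > 0`), i.e. `L(H, χ) ≅ 𝒪(Θ)^an` is a
POSITIVE line bundle.  This is Lange's Proposition 2.1.11, (i) ⇒ (ii) («ample ⇒ positive»), proved here through
(iii) ⇒ (ii) («`H⁰(Lᵈ) ≠ 0` and `K(Lᵈ)` finite ⇒ positive», the tree's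
`IsNSForm.isRiemannForm_of_thetaFunction_of_finite_kerPhiH`, Swinnerton-Dyer Lemma 21 + Lange Prop. 1.4.7):

1. `Θ` ample (`CartierDivisor.IsAmple`, Görtz–Wedhorn I Prop. 13.47 (iv)) hands `d ≥ 1` and a global section
   `s ∈ Γ(A, 𝒪(d•Θ))` whose non-vanishing locus `A_s` contains the origin `φ(0)`;
2. `HodgeTheory.exists_sectionSpace_ne_zero_of_isSection` (any analytification): the coordinates `s_i = f_i s`
   (`CartierDivisor.sectionCoord`, holomorphic by GAGA §2 n°6, rule `s_j = g_{ji} s_i`) form a NON-ZERO holomorphic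
   section of the cocycle `𝒪(d•Θ)^an = cartierDivisorLineBundle hφ (d•Θ)`;
3. `HodgeTheory.picClass_cartierDivisorLineBundle_nsmul`: `[𝒪(d•Θ)^an] = [𝒪(Θ)^an]^d = toPic (p^d)` (`(d+1)•Θ`
   and `d•Θ + Θ` present the same divisor; `picClass_cartierDivisorLineBundle_add`), so `𝒪(d•Θ)^an ≅ L(a_{p^d})`
   (`picClass_eq_toPic_iff`);
4. `ComplexTorus.exists_mem_thetaFunctions_ne_zero_of_isTrivialOn_tensor_inv` (any line bundle `L ≅ L_e` on a torus):
   a non-zero section of `L` is a non-zero theta function for `e` — lift along a frame of `π^*L` (Lange Lemma 1.2.1 /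
   Prop. 1.2.3, `IsCoverFrame.thetaEquivOfFrame`) and multiply by the coboundary function carrying the factor of the
   frame to `e` (`exists_coboundary_of_isTrivialOn_tensor_inv_of_isTrivialOn`, `mul_mem_thetaFunctions_of_coboundary`);
   hence a canonical theta function `ϑ ≢ 0` of `Lᵈ = L(dH, χᵈ)`;
5. `K(Lᵈ)` is finite: the integral Gram matrix `G` of `H` has `det G ≠ 0` for `Θ` ample
   (`det_intGram_ne_zero_of_isAmple`, via Mumford §6 App. 1 `K(Θ)` finite), and `det (d•G) = d^{#ι} det G ≠ 0`
   (`finite_kerPhiH_iff`, Lange Prop. 1.4.7);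
6. so `dH` is a Riemann form, and `H = (1/d)(dH)` is one (`IsRiemannForm.of_eq_natCast_smul`).

## References
* H. Lange, *Abelian Varieties over the Complex Numbers*, Grundlehren Text Edition (2023): §1.2.1 Lemma 1.2.1,
  Prop. 1.2.2–1.2.3 (p. 21); §1.4.2 Prop. 1.4.7; §2.1.3 Prop. 2.1.11 (p. 80). [Lange2023AbelianVarietiesComplex]
* D. Mumford, *Abelian Varieties* (1970), §6 Application 1 (p. 60). [MumfordAV1970]
* H. P. F. Swinnerton-Dyer, *Analytic Theory of Abelian Varieties* (1974), Ch. II §5 Lemma 21. [SwinnertonDyer1974AbelianVarieties]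
* U. Görtz, T. Wedhorn, *Algebraic Geometry I*, 2nd ed. (2020), Section (11.9) (p. 301), Prop. 11.21 (p. 302), Def. 13.44 (p. 391)
  and Prop. 13.47 (iv) (pp. 392–393). [GortzWedhorn2020]
* J.-P. Serre, *GAGA* (1956), §2 n°6. [SerreGAGA1956]
-/

noncomputable section

open Set Function
open scoped Manifold ContDiff Topology
open Literature.AlgebraicGeometry.Motives Literature.AlgebraicGeometry.Motives.RatFn
open Literature.Geometry.Kaehler Literature.Geometry.Kaehler.ComplexTorus
open Literature.NumberTheory.Transcendental Literature.AlgebraicGeometry.HodgeTheory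

/-! ## §1 Non-zero sections of a line bundle `L ≅ L_e` on a torus are non-zero theta functions for `e` -/

namespace Literature.Geometry.Kaehler.ComplexTorus

section Theta

variable {ι : Type*} [Fintype ι] {E : Type*} [NormedAddCommGroup E] [NormedSpace ℂ E]
  [FiniteDimensional ℂ E] {Φ : (ι → ℝ) ≃L[ℝ] E} {κ : Type*}

/-- **A non-zero holomorphic section of a line bundle `L` on `X = V/Λ` is a non-zero theta function for EVERY factor of
automorphy `e` representing `L`** (`L ⊗ L_{e⁻¹}` holomorphically trivial, i.e. `φ₁⁻¹ L = ⟦e⟧`): lift the section along a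
frame of `π^*L` to a theta function of the factor of the frame (Lange, Lemma 1.2.1 and Prop. 1.2.3), which is equivalent to
`e` ("choosing another trivialization exactly means […] an equivalent factor of automorphy"), and multiply by the coboundary
function. [cite: Lange2023AbelianVarietiesComplex, §1.2.1 Lemma 1.2.1 and Prop. 1.2.2–1.2.3 (pp. 21–22)] -/
theorem exists_mem_thetaFunctions_ne_zero_of_isTrivialOn_tensor_inv
    (L : HolomorphicLineBundle κ E (ComplexTorus Φ)) {e : (ι → ℤ) → E → ℂ} (he : IsFactor Φ e)
    (h : (L.tensor (factorLineBundle he.inv)).IsTrivialOn univ) {σ : L.sectionSpace} (hσ : σ ≠ 0) :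
    ∃ ϑ ∈ thetaFunctions Φ e, ∃ v, ϑ v ≠ 0 := by
  obtain ⟨s, hs⟩ := exists_isCoverFrame L
  -- the lift `θ₀ = (σ_k ∘ π)/s_k` of `σ`, a theta function for the factor of the frame, is non-zero
  have hθ₀ : hs.thetaEquivOfFrame.symm σ ≠ 0 := fun h0 ↦ hσ (hs.thetaEquivOfFrame.symm.map_eq_zero_iff.1 h0)
  have hθ₀' : ((hs.thetaEquivOfFrame.symm σ : thetaFunctions Φ (factorOfFrame L s)) : E → ℂ) ≠ 0 := fun h0 ↦
    hθ₀ (Subtype.ext h0)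
  obtain ⟨v, hv⟩ := Function.ne_iff.1 hθ₀'
  -- the factor of the frame and `e` both describe `L`: they are equivalent through a coboundary `K`
  obtain ⟨K, hK, hK0, hrel⟩ := exists_coboundary_of_isTrivialOn_tensor_inv_of_isTrivialOn hs.isFactor he
    hs.isTrivialOn_tensor_factorLineBundle_inv h
  exact ⟨fun w ↦ ((hs.thetaEquivOfFrame.symm σ : thetaFunctions Φ (factorOfFrame L s)) : E → ℂ) w * K w,
    mul_mem_thetaFunctions_of_coboundary Φ hK hrel (hs.thetaEquivOfFrame.symm σ).2, v, mul_ne_zero hv (hK0 v)⟩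

end Theta

section Powers

variable {ι : Type*} {E : Type*} [NormedAddCommGroup E] [NormedSpace ℂ E] {Φ : (ι → ℝ) ≃L[ℝ] E}

/-- The form of a power in `𝒫(Λ)`: `(H, χ)^m = (mH, χ^m)`, first component. [cite: Lange2023AbelianVarietiesComplex, §1.3.1 (1.10), p. 28] -/
theorem AHData.pow_form (p : AHData Φ) : ∀ m : ℕ, (p ^ m).form = (m : ℝ) • p.form
  | 0 => by rw [pow_zero, AHData.one_form, Nat.cast_zero, zero_smul]
  | m + 1 => by rw [pow_succ, AHData.mul_form, AHData.pow_form p m, Nat.cast_succ, add_smul, one_smul]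

/-- The character of a power in `𝒫(Λ)`: `(H, χ)^m = (mH, χ^m)`, second component. [cite: Lange2023AbelianVarietiesComplex, §1.3.1 (1.10), p. 28] -/
theorem AHData.pow_char (p : AHData Φ) : ∀ m : ℕ, (p ^ m).char = p.char ^ m
  | 0 => by rw [pow_zero, AHData.one_char, pow_zero]
  | m + 1 => by rw [pow_succ, AHData.mul_char, AHData.pow_char p m, pow_succ]

end Powers

end Literature.Geometry.Kaehler.ComplexTorus

namespace Literature.AlgebraicGeometry.HodgeTheory

/-! ## §2 An algebraic section of `𝒪_X(D)` is a holomorphic section of `𝒪_X(D)^an`, non-zero where `s` does not vanish -/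

section Sections

variable {X : SchemeOver ℂ} [AlgebraicGeometry.IsIntegral X.left] {n : ℕ}
  {E : Type*} [NormedAddCommGroup E] [NormedSpace ℂ E] [FiniteDimensional ℂ E]
  {M : Type*} [TopologicalSpace M] [ChartedSpace E M]
  {φ : M → ComplexPoints X} (hφ : IsAnalytification E X n φ) {D : CartierDivisor X.left}

/-- **`s ∈ Γ(X, 𝒪_X(D))` analytifies to a holomorphic section of the cocycle `𝒪_X(D)^an`, NON-ZERO as soon as the
non-vanishing locus `X_s` has a point of the analytification**: the coordinates are `s_i = (f_i s) ∘ φ`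
(`CartierDivisor.sectionCoord`; holomorphic, Serre GAGA §2 n°6; rule `s_j = g_{ji} s_i`, Görtz–Wedhorn I (11.9)),
and `s_i(m) ≠ 0` for `φ m ∈ (U_i ∩ X_s)(ℂ)`. [cite: SerreGAGA1956, §2 n°6] [cite: GortzWedhorn2020, Section (11.9) (p. 301) and Rem. 13.46 (p. 391)] -/
theorem exists_sectionSpace_ne_zero_of_isSection {s : X.left.functionField} (hs : D.IsSection s)
    {m : M} (hm : (φ m).pt ∈ D.nonvanishing s) :
    ∃ σ : (cartierDivisorLineBundle hφ D).sectionSpace, σ ≠ 0 ∧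
      ∀ (i : D.ι) (x : M), (φ x).pt ∈ D.U i → (σ : D.ι → M → ℂ) i x = D.sectionCoord φ hs i x := by
  let τ : (cartierDivisorLineBundle hφ D).GlobalSection :=
    { coord := fun i ↦ D.sectionCoord φ hs i
      mdifferentiableOn_coord := fun i ↦ mdifferentiableOn_sectionCoord hφ hs i
      coord_eq_mul := fun i j x hx ↦ sectionCoord_eq_mul hs hx.1 hx.2 }
  refine ⟨τ.normalize, ?_, fun i x hx ↦ τ.normalize_apply_of_mem hx⟩
  rw [Ne, HolomorphicLineBundle.GlobalSection.normalize_eq_zero_iff]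
  obtain ⟨i, hi⟩ := D.covers (φ m).pt
  intro huniv
  have hmz : m ∈ τ.zeroSet := huniv ▸ mem_univ m
  exact sectionCoord_ne_zero hs hi hm ((τ.mem_zeroSet_iff hi).1 hmz)

end Sections

/-! ## §3 `[𝒪_X(m • D)^an] = [𝒪_X(D)^an]^m` in `Pic(X)` -/

section Divisors

variable {ι : Type} {E : Type} [NormedAddCommGroup E] [NormedSpace ℂ E] {Φ : (ι → ℝ) ≃L[ℝ] E}
  [Fintype ι] [FiniteDimensional ℂ E]
  {X : SchemeOver ℂ} [AlgebraicGeometry.IsIntegral X.left] {n : ℕ}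
  {φ : ComplexTorus Φ → ComplexPoints X} (hφ : IsAnalytification E X n φ)

/-- **`[𝒪_X(m • D)^an] = [𝒪_X(D)^an]^m`** in `Pic(X) = H¹(Λ, H⁰(𝒪_V^*))`, for a Cartier divisor `D` on an integral
`ℂ`-scheme analytified by a complex torus: `(m + 1) • D` and `m • D + D` present the same divisor (`f_i^{m+1}/(f_a^m f_b)` are
units), so `D ↦ [𝒪_X(D)^an]` being additive (`picClass_cartierDivisorLineBundle_add`, Görtz–Wedhorn I Prop. 11.21) the
claim follows by induction; `m = 0`: `0 • D ∼ 0 • D + 0 • D`. [cite: GortzWedhorn2020, Section (11.9) (p. 301) and Prop. 11.21 (p. 302)]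
[cite: Lange2023AbelianVarietiesComplex, §1.2.1 Prop. 1.2.2 (p. 21)] -/
theorem picClass_cartierDivisorLineBundle_nsmul (D : CartierDivisor X.left) (m : ℕ) :
    picClass (cartierDivisorLineBundle hφ (m • D)) = picClass (cartierDivisorLineBundle hφ D) ^ m := by
  induction m with
  | zero =>
    have h0 : (0 • D).LinEquiv (0 • D + 0 • D) :=
      CartierDivisor.SameDivisor.linEquiv fun i p x _ _ ↦ by
        change IsUnitAt x (D.f i ^ 0 / (D.f p.1 ^ 0 * D.f p.2 ^ 0))
        rw [pow_zero, pow_zero, pow_zero, mul_one, div_one]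
        exact isUnitAt_one
    have h := picClass_cartierDivisorLineBundle_eq_of_linEquiv hφ h0
    rw [picClass_cartierDivisorLineBundle_add hφ] at h
    rw [pow_zero]
    exact left_eq_mul.1 h
  | succ m ih =>
    have h1 : ((m + 1) • D).LinEquiv (m • D + D) :=
      CartierDivisor.SameDivisor.linEquiv fun i p x hi hp ↦ by
        change IsUnitAt x (D.f i ^ (m + 1) / (D.f p.1 ^ m * D.f p.2))
        rw [pow_succ, mul_div_mul_comm, ← div_pow]
        exact ((D.isUnitAt_div i p.1 x hi hp.1).pow m).mul (D.isUnitAt_div i p.2 x hi hp.2)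
    rw [picClass_cartierDivisorLineBundle_eq_of_linEquiv hφ h1, picClass_cartierDivisorLineBundle_add hφ, ih,
      pow_succ]

end Divisors

end Literature.AlgebraicGeometry.HodgeTheory

/-! ## §4 Ample ⇒ positive on a uniformised complex abelian variety -/

namespace Literature.AlgebraicGeometry.Motives.AbelianVariety

section Uniformised

variable (A : AbelianVariety ℂ) {ι : Type} [Fintype ι] [DecidableEq ι] {Φ : (ι → ℝ) ≃L[ℝ] (Fin A.dim → ℂ)}
  {φ : ComplexTorus Φ → ComplexPoints A.X} (hφ : IsAnalytification (Fin A.dim → ℂ) A.X A.dim φ)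
  (hadd : ∀ x y, φ (x + y) = φ x * φ y)

include hadd

/-- **Lange, Prop. 2.1.11 (i) ⇒ (ii) on a complex abelian variety: an AMPLE divisor has a POSITIVE Néron–Severi form.**
For `Θ` ample on `A` and any Appell–Humbert datum `p = (H, χ)` with `L(H, χ) ≅ 𝒪_A(Θ)^an` on the uniformising torus
(`AHData.toPic p = [𝒪(Θ)^an]`), `E = Im H` is a Riemann form (`H` positive definite).  Proof through (iii) ⇒ (ii):
`Θ` ample gives `d ≥ 1` and `s ∈ Γ(𝒪(d•Θ))` with `φ 0 ∈ A_s` (Görtz–Wedhorn I Prop. 13.47 (iv)); `s` analytifies to a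
non-zero section of `𝒪(d•Θ)^an ≅ L(dH, χᵈ)` (§2, §3), hence to a canonical theta function `ϑ ≢ 0` of `Lᵈ` (§1);
`K(Lᵈ)` is finite since `det(d • G) = d^{2g} det G ≠ 0`, `det G ≠ 0` for `Θ` ample (`det_intGram_ne_zero_of_isAmple`,
Mumford §6 App. 1; Lange Prop. 1.4.7); so `dH > 0` by Swinnerton-Dyer's Lemma 21 and non-degeneracy
(`IsNSForm.isRiemannForm_of_thetaFunction_of_finite_kerPhiH`), and `H = (1/d)(dH) > 0`.
[cite: Lange2023AbelianVarietiesComplex, §2.1.3 Prop. 2.1.11 (p. 80), with §1.2.1 Prop. 1.2.3 (p. 22) and §1.4.2 Prop. 1.4.7 (pp. 38–39)]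
[cite: MumfordAV1970, §6 Application 1 (p. 60)] [cite: SwinnertonDyer1974AbelianVarieties, Ch. II §5 Lemma 21]
[cite: GortzWedhorn2020, Def. 13.44 (p. 391) and Prop. 13.47 (iv) (pp. 392–393)] -/
theorem isRiemannForm_of_isAmple {Θ : CartierDivisor A.X.left} (hΘ : Θ.IsAmple)
    (p : AHData Φ) (hp : AHData.toPic p = picClass (cartierDivisorLineBundle hφ Θ)) :
    IsRiemannForm Φ p.form := by
  -- (1) a section of `𝒪(d • Θ)`, `d ≥ 1`, non-vanishing at the origin `φ 0`
  obtain ⟨d, hd, H⟩ := hΘ.2.2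
  obtain ⟨s, hs, h0, -⟩ := H (φ 0).pt
  -- (2) its analytification: a non-zero holomorphic section of `𝒪(d • Θ)^an`
  obtain ⟨σ, hσ, -⟩ := exists_sectionSpace_ne_zero_of_isSection hφ hs h0
  -- (3) `𝒪(d • Θ)^an ≅ L(a_{p^d})`
  have hpd : picClass (cartierDivisorLineBundle hφ (d • Θ)) = (AHData.toFactor (p ^ d)).toPic := by
    rw [picClass_cartierDivisorLineBundle_nsmul hφ, ← hp, ← map_pow]
    rfl
  have htriv := (picClass_eq_toPic_iff _ _).1 hpd
  -- (4) a canonical theta function `ϑ ≢ 0` of `L(dH, χ^d)`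
  obtain ⟨ϑ, hϑ, hϑ0⟩ := exists_mem_thetaFunctions_ne_zero_of_isTrivialOn_tensor_inv
    (cartierDivisorLineBundle hφ (d • Θ)) (AHData.toFactor (p ^ d)).isFactor htriv hσ
  have hϑ' : ϑ ∈ thetaFunctions Φ (canonicalFactor Φ (p ^ d).form (p ^ d).char) := hϑ
  -- (5) `K(L^d)` is finite: `det (d • G) = d ^ #ι * det G ≠ 0`
  set G := intGram Φ p.form with hGdef
  have hGmap : G.map (Int.cast : ℤ → ℝ) = latticeGram Φ p.form := map_intGram Φ p.isNSForm_form
  have hdet : G.det ≠ 0 := A.det_intGram_ne_zero_of_isAmple hφ hadd hΘ p hp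
  have hGd : ((d : ℤ) • G).map (Int.cast : ℤ → ℝ) = latticeGram Φ (p ^ d).form := by
    ext i j
    have hij : latticeGram Φ p.form i j = (G i j : ℝ) := by
      rw [← hGmap, Matrix.map_apply]
    rw [AHData.pow_form, Matrix.map_apply, Matrix.smul_apply, smul_eq_mul, Int.cast_mul, Int.cast_natCast,
      latticeGram_apply, ContinuousAlternatingMap.smul_apply, smul_eq_mul, ← latticeGram_apply, hij]
  have hfin : Finite (kerPhiH Φ ((d : ℤ) • G)) := by
    rw [finite_kerPhiH_iff, Matrix.det_smul]
    exact mul_ne_zero (pow_ne_zero _ (by exact_mod_cast hd.ne')) hdet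
  -- (6) `dH` is a Riemann form, hence so is `H`
  have hRd : IsRiemannForm Φ (p ^ d).form :=
    (p ^ d).isNSForm_form.isRiemannForm_of_thetaFunction_of_finite_kerPhiH
      (p ^ d).isSemicharacter_char.norm_eq_one hϑ' hϑ0 hGd hfin
  exact hRd.of_eq_natCast_smul Φ p.isNSForm_form hd.ne' (AHData.pow_form p d)

/-- **Ample ⇒ positive, uniformisation-intrinsic form**: on a uniformised complex abelian variety the Néron–Severi form of
the class `[𝒪_A(Θ)^an] ∈ Pic(X)` of an AMPLE `Θ` is a Riemann form, for EVERY Appell–Humbert datum of the class (they all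
have the same form, `AHData.toPic_injective`). [cite: Lange2023AbelianVarietiesComplex, §2.1.3 Prop. 2.1.11 (p. 80)]
[cite: MumfordAV1970, §6 Application 1 (p. 60)] -/
theorem exists_ahData_isRiemannForm_of_isAmple {Θ : CartierDivisor A.X.left} (hΘ : Θ.IsAmple) :
    ∃ p : AHData Φ, AHData.toPic p = picClass (cartierDivisorLineBundle hφ Θ) ∧ IsRiemannForm Φ p.form := by
  obtain ⟨p, hp⟩ := AHData.toPic_surjective (picClass (cartierDivisorLineBundle hφ Θ))
  exact ⟨p, hp, A.isRiemannForm_of_isAmple hφ hadd hΘ p hp⟩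

end Uniformised

/-- **Every complex abelian variety carries a Riemann form coming from an ample divisor** (uniformisation-free corollary:
uniformise by `complexAbelianVariety_torusUniformised_holds`; cf. the Hodge-theoretic `isAbelianVariety_of_isAnalytification`,
which produces SOME Riemann form — here the form is `c₁` of the given ample `Θ`). [cite: Lange2023AbelianVarietiesComplex, §2.1.3 Prop. 2.1.11 (p. 80)]
[cite: MumfordAV1970, §6 Application 1 (p. 60)] -/
theorem exists_uniformisation_isRiemannForm_of_isAmple (A : AbelianVariety ℂ) {Θ : CartierDivisor A.X.left}
    (hΘ : Θ.IsAmple) :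
    ∃ (ι : Type) (_ : Fintype ι) (_ : DecidableEq ι) (Φ : (ι → ℝ) ≃L[ℝ] (Fin A.dim → ℂ))
      (φ : ComplexTorus Φ → ComplexPoints A.X) (hφ : IsAnalytification (Fin A.dim → ℂ) A.X A.dim φ)
      (_ : ∀ x y, φ (x + y) = φ x * φ y) (p : AHData Φ),
      AHData.toPic p = picClass (cartierDivisorLineBundle hφ Θ) ∧ IsRiemannForm Φ p.form := by
  obtain ⟨ι, _, _, Φ, φ, hφ, hadd⟩ := complexAbelianVariety_torusUniformised_holds A
  obtain ⟨p, hp, hR⟩ := A.exists_ahData_isRiemannForm_of_isAmple hφ hadd hΘ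
  exact ⟨ι, inferInstance, inferInstance, Φ, φ, hφ, hadd, p, hp, hR⟩

end Literature.AlgebraicGeometry.Motives.AbelianVariety

end
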